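import Summits.HodgeConjecture.HodgeConjecture.Theses.NikulinTwinTransport
import Literature.AlgebraicGeometry.HodgeTheory.ComplexConjugation
import Literature.AlgebraicGeometry.HodgeTheory.RationalLatticeIntegral
import Literature.AlgebraicGeometry.HodgeTheory.HodgeTypeConjugation
import HarnessLib

/-!
# Route NikulinTwinTransport · crux X = `TwinSimilitudeAlgebraic` (stmt-HodgeConjecture-13674) —
# line `hyperkaehler-nikulin-anchors`, heart assembly: LATTICE MARKINGS IN ANY DEGREE

Generic lemmas for an INTEGRAL LATTICE MARKING `φ : Hᵏ(X(ℂ); ℂ) ≅ ℂ^ι` of a smooth projective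
complex variety (a `ℂ`-linear equivalence identifying the integral classes with `ℤ^ι`), the shape
shared by the K3 markings `MarkedK3[S, η, p, x]` (`ι = K3Index`, `k = 2`) and the
Beauville–Bogomolov markings `MarkedK3Sq[X, φ, P, z]` of `K3^{[2]}`-type fourfolds
(`ι = K3HilbertIndex`, `k = 2`) used by the heart `HKTwinClassAssembly` of the line
(`Cruxes/TwinSimilitudeAlgebraic/Lines/hyperkaehler_nikulin_anchors.lean`, reshape r2):

* `pi_eq_sum_single_intCast`, `star_single_intCast` — the integral standard basis of `ℂ^ι` and its
  reality;
* `conjClass_latticeMarking_symm` — **markings are real**: `conj (φ⁻¹ z) = φ⁻¹ z̄` (the K3 case is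
  `conjClass_marking_symm` of `…TwinSimilitudeAlgebraicMarkings`);
* `isRationalClass_latticeMarking_symm_ratCast`, `isRationalClass_iff_of_latticeMarking` — **under a
  marking the rational classes are exactly `ℚ^ι`** (the K3 case is
  `Surfaces.isRationalClass_iff_of_marking`);
* `ratCast_map_mulVec_ratCast`, `star_ratCast_map_mulVec` — rational matrices act compatibly with
  `ℚ^ι ⊂ ℂ^ι` and commute with complex conjugation of coordinates.

All proofs are the K3 proofs with the index type and the degree generalised; no definitions, no
named facts. Prover seat prover-line-stmt-HodgeConjecture-13674-c1-0 (line lead, continuation c1).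

## References

* [VoisinHodgeI2002] C. Voisin, Hodge Theory and Complex Algebraic Geometry I, CUP 2002, §6.1.3
  Cor. 6.12 (complex conjugation on `Hᵏ(X, ℂ) = Hᵏ(X, ℝ) ⊗ ℂ`), §7.1.1.
* [HatcherAT2002] A. Hatcher, Algebraic Topology, CUP 2002, §3.1 p. 198 (change of coefficients).
* [Huybrechts2016K3] D. Huybrechts, Lectures on K3 Surfaces, CUP 2016, Ch. 6 Rem. 3.3 (markings).
-/

noncomputable section

set_option linter.dupNamespace false

open CategoryTheory
open scoped Matrix
open Literature.AlgebraicGeometry.Motives Literature.AlgebraicGeometry.HodgeTheory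
open Literature.AlgebraicTopology.SingularHomology

namespace Summit.HodgeConjecture.HodgeConjecture.Theorems.NikulinTwinTransport

section LatticeMarking

variable {ι : Type} [Fintype ι] [DecidableEq ι]

/-- Expansion of a vector of `ℂ^ι` in the integral standard basis. [folklore] -/
theorem pi_eq_sum_single_intCast (z : ι → ℂ) :
    z = ∑ j, z j • fun i => ((Pi.single j (1 : ℤ) : ι → ℤ) i : ℂ) := by
  funext i
  simp only [Finset.sum_apply, Pi.smul_apply, smul_eq_mul, Pi.single_apply, Int.cast_ite,
    Int.cast_one, Int.cast_zero, mul_ite, mul_one, mul_zero]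
  rw [Finset.sum_ite_eq, if_pos (Finset.mem_univ i)]

omit [Fintype ι] in
/-- The integral standard basis vectors of `ℂ^ι` are real. [folklore] -/
theorem star_single_intCast (j : ι) :
    star (fun i => ((Pi.single j (1 : ℤ) : ι → ℤ) i : ℂ)) =
      fun i => ((Pi.single j (1 : ℤ) : ι → ℤ) i : ℂ) := by
  funext i
  simp only [Pi.star_apply, star_intCast]

omit [Fintype ι] [DecidableEq ι] in
/-- A rational vector of `ℂ^ι` is real. [folklore] -/
theorem star_ratCast_pi (w : ι → ℚ) : star (fun i => ((w i : ℚ) : ℂ)) = fun i => ((w i : ℚ) : ℂ) := by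
  funext i
  simp only [Pi.star_apply, star_ratCast]

variable {n k : ℕ} {X : SchemeOver ℂ}

/-- **Lattice markings are real**: if `φ : Hᵏ(X(ℂ); ℂ) ≅ ℂ^ι` identifies the integral classes
with `ℤ^ι`, then complex conjugation of classes is complex conjugation of coordinates,
`conj (φ⁻¹ z) = φ⁻¹ z̄` — the basis `φ⁻¹ eⱼ` consists of integral, hence real, classes
(`IsRationalClass.conjClass_eq`). [cite: VoisinHodgeI2002, §6.1.3 Cor. 6.12] -/
theorem conjClass_latticeMarking_symm (φ : complexBetti X k ≃ₗ[ℂ] (ι → ℂ))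
    (hφ : ∀ c : complexBetti X k, IsIntegralClass c ↔ ∃ v : ι → ℤ, φ c = fun i => (v i : ℂ))
    (z : ι → ℂ) :
    conjClass (ComplexPoints X) k (φ.symm z) = φ.symm (star z) := by
  have hint : ∀ j : ι,
      IsIntegralClass (φ.symm fun i => ((Pi.single j (1 : ℤ) : ι → ℤ) i : ℂ)) := fun j =>
    (hφ _).2 ⟨Pi.single j 1, φ.apply_symm_apply _⟩
  have hsz : star z = ∑ j, star (z j) • fun i => ((Pi.single j (1 : ℤ) : ι → ℤ) i : ℂ) := by
    conv_lhs => rw [pi_eq_sum_single_intCast z]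
    rw [star_sum]
    refine Finset.sum_congr rfl fun j _ => ?_
    rw [star_smul, star_single_intCast]
  conv_lhs => rw [pi_eq_sum_single_intCast z]
  rw [hsz, map_sum, map_sum, ← conjClassEquiv_apply, map_sum]
  refine Finset.sum_congr rfl fun j _ => ?_
  rw [conjClassEquiv_apply, map_smul, map_smul, conjClass_smul,
    (hint j).isRationalClass.conjClass_eq, starRingEnd_apply]

/-- Under a lattice marking, `φ⁻¹` of a RATIONAL vector is a rational class (it is a rational
combination of the integral classes `φ⁻¹ eⱼ`). [cite: HatcherAT2002, §3.1 p. 198] -/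
theorem isRationalClass_latticeMarking_symm_ratCast (φ : complexBetti X k ≃ₗ[ℂ] (ι → ℂ))
    (hφ : ∀ c : complexBetti X k, IsIntegralClass c ↔ ∃ v : ι → ℤ, φ c = fun i => (v i : ℂ))
    (w : ι → ℚ) :
    IsRationalClass (φ.symm fun i => ((w i : ℚ) : ℂ)) := by
  have hint : ∀ j : ι,
      IsIntegralClass (φ.symm fun i => ((Pi.single j (1 : ℤ) : ι → ℤ) i : ℂ)) := fun j =>
    (hφ _).2 ⟨Pi.single j 1, φ.apply_symm_apply _⟩
  have hw : (fun i => ((w i : ℚ) : ℂ)) =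
      ∑ j, ((w j : ℚ) : ℂ) • fun i => ((Pi.single j (1 : ℤ) : ι → ℤ) i : ℂ) := by
    conv_lhs => rw [pi_eq_sum_single_intCast (fun i => ((w i : ℚ) : ℂ))]
  rw [hw, map_sum]
  refine Finset.sum_induction _ (fun c => IsRationalClass c) (fun a b ha hb => ha.add hb)
    IsRationalClass.zero fun j _ => ?_
  rw [map_smul]
  exact (hint j).isRationalClass.smul (w j)

/-- **Under a lattice marking of a smooth projective variety, the rational classes are exactly
`ℚ^ι`.**  `⟹`: a rational class has a positive integral multiple
(`IsRationalClass.exists_nsmul_isIntegralClass`), whose coordinates are integers; `⟸`: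
`isRationalClass_latticeMarking_symm_ratCast`. [cite: Huybrechts2016K3, Ch. 6 Rem. 3.3]
[cite: HatcherAT2002, §3.1 p. 198] -/
theorem isRationalClass_iff_of_latticeMarking (hX : IsSmoothProjective n X)
    (φ : complexBetti X k ≃ₗ[ℂ] (ι → ℂ))
    (hφ : ∀ c : complexBetti X k, IsIntegralClass c ↔ ∃ v : ι → ℤ, φ c = fun i => (v i : ℂ))
    (c : complexBetti X k) :
    IsRationalClass c ↔ ∃ w : ι → ℚ, φ c = fun i => ((w i : ℚ) : ℂ) := by
  constructor
  · intro hc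
    obtain ⟨N, hN, hNc⟩ := hc.exists_nsmul_isIntegralClass hX
    obtain ⟨v, hv⟩ := (hφ _).1 hNc
    refine ⟨fun i => (v i : ℚ) / N, ?_⟩
    have hN' : (N : ℂ) ≠ 0 := Nat.cast_ne_zero.2 hN.ne'
    rw [map_smul] at hv
    funext i
    have hi : (N : ℂ) * φ c i = (v i : ℂ) := by
      have := congrFun hv i
      simpa only [Pi.smul_apply, smul_eq_mul] using this
    rw [Rat.cast_div, Rat.cast_intCast, Rat.cast_natCast, ← hi]
    field_simp
  · rintro ⟨w, hw⟩
    have hc : c = φ.symm (fun i => ((w i : ℚ) : ℂ)) := by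
      rw [← hw, LinearEquiv.symm_apply_apply]
    rw [hc]
    exact isRationalClass_latticeMarking_symm_ratCast φ hφ w

/-- A rational class has rational coordinates in a lattice marking (the `⟹` half, pointwise form).
[cite: Huybrechts2016K3, Ch. 6 Rem. 3.3] -/
theorem exists_ratCast_of_isRationalClass (hX : IsSmoothProjective n X)
    (φ : complexBetti X k ≃ₗ[ℂ] (ι → ℂ))
    (hφ : ∀ c : complexBetti X k, IsIntegralClass c ↔ ∃ v : ι → ℤ, φ c = fun i => (v i : ℂ))
    {c : complexBetti X k} (hc : IsRationalClass c) :
    ∃ w : ι → ℚ, φ c = fun i => ((w i : ℚ) : ℂ) :=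
  (isRationalClass_iff_of_latticeMarking hX φ hφ c).1 hc

/-! ### Rational matrices on `ℚ^ι ⊂ ℂ^ι` -/

omit [DecidableEq ι] in
/-- Rational matrices act compatibly with the inclusion `ℚ^ι ⊂ ℂ^ι`. [folklore] -/
theorem ratCast_map_mulVec_ratCast {κ : Type} [Fintype κ] (M : Matrix κ ι ℚ) (v : ι → ℚ) :
    (M.map (fun q : ℚ => (q : ℂ))) *ᵥ (fun i => ((v i : ℚ) : ℂ)) = fun i => (((M *ᵥ v) i : ℚ) : ℂ) := by
  funext i
  simp only [Matrix.mulVec, dotProduct, Matrix.map_apply, Rat.cast_sum, Rat.cast_mul]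

omit [DecidableEq ι] in
/-- A rational matrix commutes with complex conjugation of coordinates: `\overline{M a} = M ā`.
[folklore] -/
theorem star_ratCast_map_mulVec {κ : Type} [Fintype κ] (M : Matrix κ ι ℚ) (a : ι → ℂ) :
    star ((M.map (fun q : ℚ => (q : ℂ))) *ᵥ a) = (M.map (fun q : ℚ => (q : ℂ))) *ᵥ star a := by
  funext i
  simp only [Pi.star_apply, Matrix.mulVec, dotProduct, Matrix.map_apply, star_sum, star_mul',
    star_ratCast]

omit [DecidableEq ι] in
/-- A rational matrix maps rational vectors of `ℂ^ι` to rational vectors. [folklore] -/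
theorem exists_ratCast_map_mulVec {κ : Type} [Fintype κ] (M : Matrix κ ι ℚ) (v : ι → ℚ) :
    ∃ w : κ → ℚ, (M.map (fun q : ℚ => (q : ℂ))) *ᵥ (fun i => ((v i : ℚ) : ℂ)) =
      fun i => ((w i : ℚ) : ℂ) :=
  ⟨M *ᵥ v, ratCast_map_mulVec_ratCast M v⟩

end LatticeMarking

/-- Registered anchor of this helper file (the gate's `--supports` check matches a registered
name + signature): the reality of lattice markings, in closed form. [cite: VoisinHodgeI2002, §6.1.3 Cor. 6.12] -/
theorem hkMarkedSq_conjClass_anchor : ∀ {ι : Type} [Fintype ι] [DecidableEq ι] {k : ℕ} {X : SchemeOver ℂ} (φ : complexBetti X k ≃ₗ[ℂ] (ι → ℂ)), (∀ c : complexBetti X k, IsIntegralClass c ↔ ∃ v : ι → ℤ, φ c = fun i => (v i : ℂ)) → ∀ (z : ι → ℂ), conjClass (ComplexPoints X) k (φ.symm z) = φ.symm (star z) :=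
  fun φ hφ z => conjClass_latticeMarking_symm φ hφ z


end Summit.HodgeConjecture.HodgeConjecture.Theorems.NikulinTwinTransport

end
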